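import Mathlib.Data.List.Basic
import Mathlib.Data.Nat.Bitwise
import Std.Sat.CNF
import HarnessLib

/-!
# Kernel-B distance certificates, K2 half: the Lean CNF encoder `cnfEncode` (spec `enc-v1`) and its
ENCODING-SOUNDNESS theorem

Cell `qec` (LADDER-QEC, rung Q2/Q3), PARTITION v2 row type-11.  A solver certificate for a lower bound
`d ≥ D` on the `X`- (resp. `Z`-) distance of a CSS code consists of LRAT refutations of the CNFs
`Q(H, u_j, D-1)`: "there is `v ∈ 𝔽₂ⁿ` with `H v = 0`, `⟨u_j, v⟩ = 1`, `wt v ≤ D-1`" (`H` = the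
opposite-type check matrix given by the SUPPORTS of its rows, `u_j` = the support of the `j`-th
same-type logical operator).  The refutation is checked by Lean core's verified LRAT checker
(`Std.Tactic.BVDecide.LRAT.check_sound`, file `LRATBridge.lean`); what must be proved HERE, once, is
that the CNF the solver refuted really encodes the question (director-qec D1 (ii)):

* `cnfEncode n rows u w : Std.Sat.CNF Nat` — the formula, generated clause-for-clause in the frozen
  numbering / clause ORDER of the spec `enc-v1` (qec-search-2 `kb/encode.py`, re-implemented by
  qec-ref-1), so that `Std.Sat.CNF.dimacs (cnfEncode …)` is byte-identical (after the `p cnf` header)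
  to the DIMACS the solver saw and the LRAT clause ids line up (variable `v` of `CNF Nat` is DIMACS
  variable `v+1`, clause `i` of the array is LRAT id `i+1` — the conventions of `CNF.dimacs` and of
  `LRAT.Internal.CNF.convertLRAT`).  Coordinates `0 … n-1` are the variables `0 … n-1`; auxiliary
  variables are allocated upward from `n` in generation order.
  (1) for each row `r` (list of coordinates, increasing), in order: `XOR(r) = 0`;
  (2) `XOR(u) = 1`;
  (3) `AtMost w (x_0 … x_{n-1})` by the Sinz sequential counter `LT_SEQ` [Sinz, CP 2005, LNCS 3709].
  `XOR(S) = p` with `|S| ≤ 6` is DIRECT: one clause per 0/1-pattern of `S` of parity `≠ p`, patterns in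
  binary counting order (first literal most significant), literal `x` positive iff its pattern bit is 0;
  `|S| > 6`: repeatedly replace the first five entries by a fresh `y` with the direct clauses of
  `XOR(c₁…c₅, y) = 0`, the running list becoming `y :: rest`, and finish directly at length `≤ 6`.
* `cnfEncodeAny n rows us w` — variant `Q_any(H, U, w)`: block (2) becomes, for each `u_j` in order, a
  fresh `t_j` (allocated before that chain's auxiliaries) with the chained `XOR(u_j ++ [t_j]) = 0`, then
  the single clause `t_1 ∨ … ∨ t_k`; then block (3).  (Base CNF of the pinned `enc-v2` leaves, which
  append unit/cube clauses on coordinate variables — see `sat_append_coordClauses`.)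
* `Solves n rows u w a` / `SolvesAny n rows us w a` — the question itself, for a Boolean assignment
  `a : ℕ → Bool` of the coordinates (only `a 0 … a (n-1)` matter): every row has even parity, `u` has
  odd parity (resp. some `u_j` has), and `#{i < n | a i} ≤ w`.
* ENCODING SOUNDNESS (= completeness of the encoding, the direction a LOWER bound needs):
  `cnfEncode_sat_of_solves` — a solution extends to a model (auxiliaries := the partial parities and
  `s_{i,j} := [x_1 + ⋯ + x_i ≥ j]`), hence `cnfEncode_unsat_imp : (cnfEncode n rows u w).Unsat → ¬ ∃ a,
  Solves n rows u w a`, and the `Any` twins.  Hypotheses: all coordinates in `rows`/`u` are `< n`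
  (otherwise a coordinate variable would collide with an auxiliary); NO sortedness / duplicate-freeness
  is needed for soundness (parity is taken with multiplicity), only for byte-identity with the spec.

Not here: the LRAT hook and the bridge to `CSSCode.dX/dZ` (file `LRATBridge.lean`), the K1
enumeration checker (type-10), solver runs (search-2), DIMACS/LRAT plumbing (search-10).  All
definitions are computable and structurally recursive (fuelled), so `decide`/`native_decide`/`#eval`
evaluate them.
-/

namespace Summit.Ventures.QEC.Census.CNFEncode

open Std.Sat

/-- A clause over `ℕ`-indexed variables: list of literals `(x, b)`, satisfied by `a` iff `a x = b`
for some literal (Lean core `Std.Sat.CNF.Clause`). -/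
abbrev Clause : Type := CNF.Clause Nat

/-! ## Semantics of the question -/

/-- Parity (XOR) of the assignment `a` over a list of coordinates, with multiplicity. -/
def lparity (a : ℕ → Bool) : List ℕ → Bool
  | [] => false
  | x :: xs => xor (a x) (lparity a xs)

/-- Number of coordinates `i < n` set to `true` by `a` (the Hamming weight of `a` on `[0,n)`). -/
def weight (a : ℕ → Bool) (n : ℕ) : ℕ := (List.range n).countP (fun i => a i)

/-- `a` solves `Q(H,u,w)`: every row of `H` (given by its support) has even overlap with `a`, `u` has
odd overlap, and the weight of `a` on the `n` coordinates is at most `w`. -/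
def Solves (n : ℕ) (rows : List (List ℕ)) (u : List ℕ) (w : ℕ) (a : ℕ → Bool) : Prop :=
  (∀ r ∈ rows, lparity a r = false) ∧ lparity a u = true ∧ weight a n ≤ w

/-- `a` solves `Q_any(H,U,w)`: rows even, SOME `u ∈ us` odd, weight `≤ w`. -/
def SolvesAny (n : ℕ) (rows : List (List ℕ)) (us : List (List ℕ)) (w : ℕ) (a : ℕ → Bool) : Prop :=
  (∀ r ∈ rows, lparity a r = false) ∧ (∃ u ∈ us, lparity a u = true) ∧ weight a n ≤ w

/-! ## The encoder (spec `enc-v1`) -/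

/-- Parity of the low `|xs|` bits of the pattern number `q` (position `i` of `xs` carries bit
`|xs| - 1 - i`). -/
def patternParity : List ℕ → ℕ → Bool
  | [], _ => false
  | _ :: xs, q => xor (q.testBit xs.length) (patternParity xs q)

/-- The clause forbidding the 0/1-pattern `q` on the variables `xs` (first variable = most
significant bit): variable `x` occurs positively iff its pattern bit is `0`. -/
def patternClause : List ℕ → ℕ → Clause
  | [], _ => []
  | x :: xs, q => (x, !(q.testBit xs.length)) :: patternClause xs q

/-- DIRECT encoding of `XOR(xs) = p`: the clauses forbidding every pattern of parity `≠ p`, in binary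
counting order of the pattern. (`xs = []`: the empty clause if `p = true`, nothing if `p = false`.) -/
def xorDirect (xs : List ℕ) (p : Bool) : List Clause :=
  ((List.range (2 ^ xs.length)).filter fun q => patternParity xs q != p).map (patternClause xs)

/-- CHAINED encoding of `XOR(xs) = p` starting at the next free variable `nv`; returns the clauses and
the next free variable.  While more than six entries remain, the first five `c₁…c₅` are replaced by a
fresh `y` (`= nv`) with the direct clauses of `XOR(c₁,…,c₅,y) = 0` and the list becomes `y :: rest`.
`fuel` bounds the number of rounds (`|xs|` always suffices). -/
def xorChain : ℕ → ℕ → List ℕ → Bool → List Clause × ℕ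
  | 0, nv, xs, p => (xorDirect xs p, nv)
  | fuel + 1, nv, xs, p =>
    if xs.length ≤ 6 then (xorDirect xs p, nv)
    else
      let r := xorChain fuel (nv + 1) (nv :: xs.drop 5) p
      (xorDirect (xs.take 5 ++ [nv]) false ++ r.1, r.2)

/-- Block (1): the chained `XOR(r) = 0` constraints of the rows, in order, threading the free-variable
counter. -/
def encRows : ℕ → List (List ℕ) → List Clause × ℕ
  | nv, [] => ([], nv)
  | nv, r :: rs =>
    let a := xorChain r.length nv r false
    let b := encRows a.2 rs
    (a.1 ++ b.1, b.2)

/-- The Sinz sequential-counter variable `s_{i,j}` (`1 ≤ i ≤ N-1`, `1 ≤ j ≤ w`) when the counter block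
starts at free variable `nv`: `nv + (i-1)·w + (j-1)` (DIMACS `base + (i-1)·w + j`). -/
def svar (w nv i j : ℕ) : ℕ := nv + (i - 1) * w + (j - 1)

/-- Block (3): `AtMost w` over the coordinate variables `x_1 … x_N := 0 … N-1` by the Sinz `LT_SEQ`
sequential counter with auxiliaries from `nv` on, clauses in the order of [Sinz 2005]:
`(¬x₁ ∨ s₁₁)`, `(¬s₁ⱼ)` for `1<j≤w`; for `1<i<N`: `(¬xᵢ ∨ sᵢ₁)`, `(¬sᵢ₋₁,₁ ∨ sᵢ₁)`, for `1<j≤w`: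
`(¬xᵢ ∨ ¬sᵢ₋₁,ⱼ₋₁ ∨ sᵢⱼ)`, `(¬sᵢ₋₁,ⱼ ∨ sᵢⱼ)`, then `(¬xᵢ ∨ ¬sᵢ₋₁,w)`; finally `(¬x_N ∨ ¬s_{N-1,w})`.
Degenerate cases as in the spec: `w ≥ N` no clauses, `w = 0` the units `¬xᵢ`. Uses `(N-1)·w`
auxiliaries. -/
def atMost (N w nv : ℕ) : List Clause :=
  if N ≤ w then []
  else if w = 0 then (List.range N).map fun i => [(i, false)]
  else
    [[(0, false), (svar w nv 1 1, true)]] ++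
    ((List.range' 2 (w - 1)).map fun j => [(svar w nv 1 j, false)]) ++
    ((List.range' 2 (N - 2)).flatMap fun i =>
      [[(i - 1, false), (svar w nv i 1, true)], [(svar w nv (i - 1) 1, false), (svar w nv i 1, true)]] ++
      ((List.range' 2 (w - 1)).flatMap fun j =>
        [[(i - 1, false), (svar w nv (i - 1) (j - 1), false), (svar w nv i j, true)],
         [(svar w nv (i - 1) j, false), (svar w nv i j, true)]]) ++
      [[(i - 1, false), (svar w nv (i - 1) w, false)]]) ++
    [[(N - 1, false), (svar w nv (N - 1) w, false)]]

/-- `cnfEncode n rows u w`: the CNF `Q(H,u,w)` of spec `enc-v1` — block (1) rows, block (2)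
`XOR(u) = 1`, block (3) `AtMost w`; coordinates are variables `0 … n-1`, auxiliaries from `n` up. -/
def cnfEncode (n : ℕ) (rows : List (List ℕ)) (u : List ℕ) (w : ℕ) : CNF Nat :=
  let r1 := encRows n rows
  let r2 := xorChain u.length r1.2 u true
  ⟨(r1.1 ++ r2.1 ++ atMost n w r2.2).toArray⟩

/-- Block (2′) of `Q_any`: for each `u_j` in order a fresh indicator `t_j := nv` followed by the
chained `XOR(u_j ++ [t_j]) = 0`; returns clauses, next free variable, and the list of the `t_j`. -/
def encLogicals : ℕ → List (List ℕ) → List Clause × ℕ × List ℕ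
  | nv, [] => ([], nv, [])
  | nv, u :: us =>
    let a := xorChain (u.length + 1) (nv + 1) (u ++ [nv]) false
    let b := encLogicals a.2 us
    (a.1 ++ b.1, b.2.1, nv :: b.2.2)

/-- `cnfEncodeAny n rows us w`: the CNF `Q_any(H,U,w)` of spec `enc-v1` — rows, indicators `t_j` with
their chains, the clause `t_1 ∨ ⋯ ∨ t_k`, then `AtMost w`. -/
def cnfEncodeAny (n : ℕ) (rows : List (List ℕ)) (us : List (List ℕ)) (w : ℕ) : CNF Nat :=
  let r1 := encRows n rows
  let r2 := encLogicals r1.2 us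
  ⟨(r1.1 ++ r2.1 ++ [r2.2.2.map fun t => (t, true)] ++ atMost n w r2.2.1).toArray⟩

/-- Number of variables used by `cnfEncode` (the `p cnf` header value of the spec). -/
def cnfEncodeNumVars (n : ℕ) (rows : List (List ℕ)) (u : List ℕ) (w : ℕ) : ℕ :=
  let r1 := encRows n rows
  let r2 := xorChain u.length r1.2 u true
  if n ≤ w ∨ w = 0 then r2.2 else r2.2 + (n - 1) * w


/-! ## Proof devices (used by the soundness files) -/

/-- Partial count: number of `true` coordinates among `x_1 … x_i` (variables `0 … i-1`). -/
def pcount (a : ℕ → Bool) (i : ℕ) : ℕ := (List.range i).countP fun k => a k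

/-- The model of the counter block: `s_{i,j} := [pcount i ≥ j]`, other variables unchanged. -/
def counterModel (a : ℕ → Bool) (N w nv : ℕ) (v : ℕ) : Bool :=
  if nv ≤ v ∧ v < nv + (N - 1) * w then decide ((v - nv) % w + 1 ≤ pcount a ((v - nv) / w + 1))
  else a v

end Summit.Ventures.QEC.Census.CNFEncode
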